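import Mathlib.Analysis.Fourier.LpSpace
import Mathlib.Analysis.Calculus.LineDeriv.IntegrationByParts
import Mathlib.Analysis.Distribution.AEEqOfIntegralContDiff
import HarnessLib

/-!
# Route PerpetualPump · `EulerTypeIGlue` — toolkit III: iterated directional derivatives under
# the `L²` Fourier transform and the weighted Plancherel identity

Support file for the support item `EulerTypeIGlue` (stmt-NavierStokesRegularity-1838). For a
smooth `f : V → F` (finite-dimensional real inner product space `V`, complex Hilbert space `F`)
whose iterated derivatives up to order `k` are square integrable, the `k`-th derivative along a
fixed direction `m`, `D_m^k f (x) = D^k f(x)(m, …, m)`, has Plancherel transform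
`(2πi⟨ξ,m⟩)^k f̂(ξ)` (iteration of the first-order statement
`fourier_toLp_fderiv_ae_eq'`, reproved here so that this file is self-contained), whence the
**weighted Plancherel identity** `∫ |2π⟨ξ,m⟩|^{2k} ‖f̂(ξ)‖² dξ = ‖D_m^k f‖²_{L²} ≤ ‖m‖^{2k} ‖D^k f‖²_{L²}`:
polynomial Fourier weights are controlled by physical-space Sobolev norms, for functions that are
in `H^k` but not in `L¹`.

## References

* E. M. Stein, G. Weiss, *Introduction to Fourier Analysis on Euclidean Spaces* (1971), Ch. I
  §1 (Thm. 1.8) and §3.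
* T. Tao, J. Amer. Math. Soc. 29 (2016), arXiv:1402.0290v3, §1.1 p. 3. [Tao2016AveragedNS]
-/

noncomputable section

open MeasureTheory Set Filter Topology FourierTransform SchwartzMap TemperedDistribution
open scoped ENNReal NNReal FourierTransform RealInnerProductSpace ContDiff LineDeriv

set_option linter.dupNamespace false

namespace Summit.NavierStokesRegularity.NavierStokesRegularity.Theorems.PerpetualPumpEulerTypeIGlue

variable {V : Type*} [NormedAddCommGroup V] [InnerProductSpace ℝ V] [FiniteDimensional ℝ V]
  [MeasurableSpace V] [BorelSpace V]
variable {F : Type*} [NormedAddCommGroup F] [InnerProductSpace ℂ F] [CompleteSpace F]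

/-! ### Directional iterated derivatives `x ↦ D^k f(x)(m,…,m)` -/

omit [InnerProductSpace ℝ V] [FiniteDimensional ℝ V] [MeasurableSpace V] [BorelSpace V]
  [InnerProductSpace ℂ F] [CompleteSpace F] in
/-- `‖D^k f(x)(m,…,m)‖ ≤ ‖D^k f(x)‖ ‖m‖^k`. [folklore] -/
theorem norm_iteratedFDeriv_const_le [NormedSpace ℝ V] [NormedSpace ℝ F] (f : V → F) (k : ℕ)
    (m : V) (x : V) :
    ‖iteratedFDeriv ℝ k f x (fun _ : Fin k => m)‖ ≤ ‖iteratedFDeriv ℝ k f x‖ * ‖m‖ ^ k := by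
  have h := (iteratedFDeriv ℝ k f x).le_opNorm (fun _ : Fin k => m)
  rwa [Finset.prod_const, Finset.card_univ, Fintype.card_fin] at h

omit [InnerProductSpace ℝ V] [FiniteDimensional ℝ V] [MeasurableSpace V] [BorelSpace V]
  [InnerProductSpace ℂ F] [CompleteSpace F] in
/-- The directional iterated derivative of a smooth function is smooth. [folklore] -/
theorem contDiff_iteratedFDeriv_const [NormedSpace ℝ V] [NormedSpace ℝ F] {f : V → F}
    (hf : ContDiff ℝ (⊤ : ℕ∞) f) (k : ℕ) (m : V) :
    ContDiff ℝ (⊤ : ℕ∞) (fun x => iteratedFDeriv ℝ k f x (fun _ : Fin k => m)) := by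
  have h1 : ContDiff ℝ (⊤ : ℕ∞) (iteratedFDeriv ℝ k f) :=
    hf.iteratedFDeriv_right (by exact_mod_cast le_top)
  exact (ContinuousMultilinearMap.apply ℝ (fun _ : Fin k => V) F (fun _ : Fin k => m)).contDiff.comp h1

omit [InnerProductSpace ℝ V] [FiniteDimensional ℝ V] [MeasurableSpace V] [BorelSpace V]
  [InnerProductSpace ℂ F] [CompleteSpace F] in
/-- **Recursion**: `D^{k+1} f(x)(m,…,m) = ∂_m [x ↦ D^k f(x)(m,…,m)]` for smooth `f`. [folklore] -/
theorem iteratedFDeriv_const_succ_eq [NormedSpace ℝ V] [NormedSpace ℝ F] {f : V → F}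
    (hf : ContDiff ℝ (⊤ : ℕ∞) f) (k : ℕ) (m : V) (x : V) :
    iteratedFDeriv ℝ (k + 1) f x (fun _ : Fin (k + 1) => m) =
      fderiv ℝ (fun y => iteratedFDeriv ℝ k f y (fun _ : Fin k => m)) x m := by
  have hdiff : DifferentiableAt ℝ (iteratedFDeriv ℝ k f) x :=
    ((hf.iteratedFDeriv_right (i := k) (m := 1) (by exact_mod_cast le_top)).differentiable
      one_ne_zero).differentiableAt
  rw [iteratedFDeriv_succ_apply_left, fderiv_continuousMultilinear_apply_const hdiff,
    ContinuousLinearMap.flipMultilinear_apply_apply]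
  rfl

/-- `∫⁻ ‖g‖ₑ² = ‖g‖²_{L²}`. [folklore] -/
theorem lintegral_enorm_sq_eq_eLpNorm_sq {α : Type*} [MeasurableSpace α] (μ : Measure α)
    {G : Type*} [NormedAddCommGroup G] (g : α → G) : ∫⁻ x, ‖g x‖ₑ ^ 2 ∂μ = eLpNorm g 2 μ ^ 2 := by
  have h := eLpNorm_nnreal_pow_eq_lintegral (f := g) (μ := μ) (p := (2 : ℝ≥0)) two_ne_zero
  simp only [ENNReal.coe_ofNat, NNReal.coe_ofNat, ENNReal.rpow_two] at h
  rw [h]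

omit [InnerProductSpace ℂ F] [CompleteSpace F] in
/-- A continuous function with `∫⁻ ‖g‖ₑ² < ∞` is in `L²`. [folklore] -/
theorem memLp_two_of_continuous_of_lintegral {g : V → F} (hg : Continuous g)
    (h : ∫⁻ x, ‖g x‖ₑ ^ 2 < ⊤) : MemLp g 2 (volume : Measure V) := by
  refine ⟨hg.aestronglyMeasurable, ?_⟩
  rw [lintegral_enorm_sq_eq_eLpNorm_sq] at h
  refine lt_top_iff_ne_top.2 fun htop => ?_
  rw [htop] at h
  simp at h

omit [CompleteSpace F] in
/-- The directional iterated derivatives of a smooth function with `D^k f ∈ L²` are in `L²`. [folklore] -/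
theorem memLp_iteratedFDeriv_const {f : V → F} (hf : ContDiff ℝ (⊤ : ℕ∞) f) {k : ℕ}
    (hk : ∫⁻ x, ‖iteratedFDeriv ℝ k f x‖ₑ ^ 2 < ⊤) (m : V) :
    MemLp (fun x => iteratedFDeriv ℝ k f x (fun _ : Fin k => m)) 2 (volume : Measure V) := by
  have hcont : Continuous (iteratedFDeriv ℝ k f) :=
    hf.continuous_iteratedFDeriv (by exact_mod_cast le_top)
  have hD : MemLp (iteratedFDeriv ℝ k f) 2 (volume : Measure V) :=
    memLp_two_of_continuous_of_lintegral hcont hk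
  refine MemLp.of_le_mul (c := ‖m‖ ^ k) hD (contDiff_iteratedFDeriv_const hf k m).continuous.aestronglyMeasurable
    (Eventually.of_forall fun x => ?_)
  rw [mul_comm]
  exact norm_iteratedFDeriv_const_le f k m x

/-! ### Plancherel in `lintegral` form -/

/-- **Plancherel, `lintegral` form**: `∫⁻ ‖𝓕u‖ₑ² = ∫⁻ ‖u‖ₑ²` for `u ∈ L²(V; F)`. [folklore] -/
theorem lintegral_enorm_sq_fourier_eq (u : Lp F 2 (volume : Measure V)) :
    ∫⁻ ξ, ‖((𝓕 u : Lp F 2 (volume : Measure V)) : V → F) ξ‖ₑ ^ 2 = ∫⁻ x, ‖(u : V → F) x‖ₑ ^ 2 := by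
  rw [lintegral_enorm_sq_eq_eLpNorm_sq, lintegral_enorm_sq_eq_eLpNorm_sq, ← Lp.enorm_def,
    ← Lp.enorm_def, ← ofReal_norm, ← ofReal_norm, Lp.norm_fourier_eq]

/-! ### `𝓕[D_m^k f] = (2πi⟨ξ,m⟩)^k 𝓕[f]` -/

/-- **The `L²` Fourier transform of a directional iterated derivative**: for smooth `f` with
`D^j f ∈ L²` for `j ≤ k`, `𝓕[D_m^k f](ξ) = (2πi ⟨ξ,m⟩)^k 𝓕[f](ξ)` a.e. (iteration of the
first-order statement supplied as the hypothesis `hstep`, cf. toolkit II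
`fourier_toLp_fderiv_ae_eq`). [folklore] -/
theorem fourier_toLp_iteratedFDeriv_const_ae_eq_of_step
    (hstep : ∀ {g : V → F} (_ : ContDiff ℝ 1 g) (m : V) (hg2 : MemLp g 2 volume)
      (hd2 : MemLp (fun x => fderiv ℝ g x m) 2 volume),
      ((𝓕 (hd2.toLp _) : Lp F 2 (volume : Measure V)) : V → F) =ᵐ[volume]
        fun ξ => ((2 * Real.pi * Complex.I) * ((⟪ξ, m⟫ : ℝ) : ℂ)) •
          ((𝓕 (hg2.toLp g) : Lp F 2 (volume : Measure V)) : V → F) ξ)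
    {f : V → F} (hf : ContDiff ℝ (⊤ : ℕ∞) f) (m : V) (k : ℕ)
    (hint : ∀ j ≤ k, ∫⁻ x, ‖iteratedFDeriv ℝ j f x‖ₑ ^ 2 < ⊤) (hf2 : MemLp f 2 volume) :
    ((𝓕 ((memLp_iteratedFDeriv_const hf (hint k le_rfl) m).toLp _) : Lp F 2 (volume : Measure V)) :
        V → F) =ᵐ[volume]
      fun ξ => ((2 * Real.pi * Complex.I) * ((⟪ξ, m⟫ : ℝ) : ℂ)) ^ k •
        ((𝓕 (hf2.toLp f) : Lp F 2 (volume : Measure V)) : V → F) ξ := by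
  induction k with
  | zero =>
    have h0 : (memLp_iteratedFDeriv_const hf (hint 0 le_rfl) m).toLp _ = hf2.toLp f := by
      refine MemLp.toLp_congr _ _ (Eventually.of_forall fun x => ?_)
      simp only [iteratedFDeriv_zero_apply]
    rw [h0]
    exact Eventually.of_forall fun ξ => by simp only [pow_zero, one_smul]
  | succ k ih =>
    have hint' : ∀ j ≤ k, ∫⁻ x, ‖iteratedFDeriv ℝ j f x‖ₑ ^ 2 < ⊤ := fun j hj =>
      hint j (hj.trans (Nat.le_succ k))
    have ihk := ih hint'
    -- the `k`-th directional derivative `g` and its derivative along `m`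
    set g : V → F := fun x => iteratedFDeriv ℝ k f x (fun _ : Fin k => m) with hg
    have hgs : ContDiff ℝ (⊤ : ℕ∞) g := contDiff_iteratedFDeriv_const hf k m
    have hg1 : ContDiff ℝ 1 g := hgs.of_le (by exact_mod_cast le_top)
    have hg2 : MemLp g 2 volume := memLp_iteratedFDeriv_const hf (hint' k le_rfl) m
    have hsucc : MemLp (fun x => iteratedFDeriv ℝ (k + 1) f x (fun _ : Fin (k + 1) => m)) 2 volume :=
      memLp_iteratedFDeriv_const hf (hint (k + 1) le_rfl) m
    have hfun : (fun x => fderiv ℝ g x m) =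
        fun x => iteratedFDeriv ℝ (k + 1) f x (fun _ : Fin (k + 1) => m) :=
      funext fun x => (iteratedFDeriv_const_succ_eq hf k m x).symm
    have hd2 : MemLp (fun x => fderiv ℝ g x m) 2 volume := by rw [hfun]; exact hsucc
    have hstepg := hstep hg1 m hg2 hd2
    -- identify the `L²` classes
    have hcl1 : (memLp_iteratedFDeriv_const hf (hint (k + 1) le_rfl) m).toLp _ = hd2.toLp _ := by
      refine MemLp.toLp_congr _ _ (Eventually.of_forall fun x => ?_)
      exact iteratedFDeriv_const_succ_eq hf k m x
    have hcl2 : hg2.toLp g = (memLp_iteratedFDeriv_const hf (hint' k le_rfl) m).toLp _ := rfl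
    rw [hcl1]
    filter_upwards [hstepg, ihk] with ξ h1 h2
    rw [h1, hcl2, h2, smul_smul, pow_succ, mul_comm]

/-- **Weighted Plancherel identity**: under the same hypotheses,
`∫ ‖(2πi⟨ξ,m⟩)^k‖² ‖f̂(ξ)‖² dξ = ∫ ‖D_m^k f‖²`. [folklore] -/
theorem lintegral_weight_pow_mul_enorm_fourier_sq_eq_of_step
    (hstep : ∀ {g : V → F} (_ : ContDiff ℝ 1 g) (m : V) (hg2 : MemLp g 2 volume)
      (hd2 : MemLp (fun x => fderiv ℝ g x m) 2 volume),
      ((𝓕 (hd2.toLp _) : Lp F 2 (volume : Measure V)) : V → F) =ᵐ[volume]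
        fun ξ => ((2 * Real.pi * Complex.I) * ((⟪ξ, m⟫ : ℝ) : ℂ)) •
          ((𝓕 (hg2.toLp g) : Lp F 2 (volume : Measure V)) : V → F) ξ)
    {f : V → F} (hf : ContDiff ℝ (⊤ : ℕ∞) f) (m : V) (k : ℕ)
    (hint : ∀ j ≤ k, ∫⁻ x, ‖iteratedFDeriv ℝ j f x‖ₑ ^ 2 < ⊤) (hf2 : MemLp f 2 volume) :
    ∫⁻ ξ, ‖((2 * Real.pi * Complex.I) * ((⟪ξ, m⟫ : ℝ) : ℂ)) ^ k‖ₑ ^ 2 *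
        ‖((𝓕 (hf2.toLp f) : Lp F 2 (volume : Measure V)) : V → F) ξ‖ₑ ^ 2 =
      ∫⁻ x, ‖iteratedFDeriv ℝ k f x (fun _ : Fin k => m)‖ₑ ^ 2 := by
  have hD := memLp_iteratedFDeriv_const hf (hint k le_rfl) m
  have hae := fourier_toLp_iteratedFDeriv_const_ae_eq_of_step hstep hf m k hint hf2
  calc ∫⁻ ξ, ‖((2 * Real.pi * Complex.I) * ((⟪ξ, m⟫ : ℝ) : ℂ)) ^ k‖ₑ ^ 2 *
          ‖((𝓕 (hf2.toLp f) : Lp F 2 (volume : Measure V)) : V → F) ξ‖ₑ ^ 2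
      = ∫⁻ ξ, ‖((𝓕 (hD.toLp _) : Lp F 2 (volume : Measure V)) : V → F) ξ‖ₑ ^ 2 := by
        refine lintegral_congr_ae ?_
        filter_upwards [hae] with ξ hξ
        rw [hξ, enorm_smul]
        ring
    _ = ∫⁻ x, ‖((hD.toLp _ : Lp F 2 (volume : Measure V)) : V → F) x‖ₑ ^ 2 :=
        lintegral_enorm_sq_fourier_eq _
    _ = ∫⁻ x, ‖iteratedFDeriv ℝ k f x (fun _ : Fin k => m)‖ₑ ^ 2 := by
        refine lintegral_congr_ae ?_
        filter_upwards [hD.coeFn_toLp] with x hx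
        rw [hx]

end Summit.NavierStokesRegularity.NavierStokesRegularity.Theorems.PerpetualPumpEulerTypeIGlue

end
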